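import Summits.NavierStokesRegularity.NavierStokesRegularity.Theses.SymmetryModuliCount
import Literature.Analysis.FluidPDE.TypeIAncientMild
import Summits.NavierStokesRegularity.NavierStokesRegularity.Theorems.SymmetricLiouville.Negative.LoadBearing

/-!
# Crux `SymmetricLiouville` (stmt-NavierStokesRegularity-4053), negative side:
load-bearing hypotheses of the stubs of line `blowdown-kills-pitch`

Drefute (D-0016) support lemmas for `Cruxes/SymmetricLiouville/Lines/blowdown-kills-pitch.lean` (planner
version and the lead's reshape) of route `SymmetryModuliCount`. Every registered stub there is stated over
the FULL class `IsTypeIAncientMild C u`; here one class hypothesis (or the side condition of the kinematic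
stub) is dropped at a time and the mutant is refuted by an explicit witness, so the lead knows which
hypothesis each stub proof must consume. Nothing here asserts a route statement or closes an item.

* `screwIsPeriodic_false_of_mem_range` — stub 1 with `a ∉ range A` flipped to `a ∈ range A`, `A ≠ 0`:
  FALSE (`A = J`, `a = 0`, `v = id` has no period). Rotations carry no length.
* `periodicBlowdownVanishing_false_without_mild` / `_without_typeI` — the lever without the Oseen
  integral equation (witness `(−t)^{-1/2}f₀`, scale-invariant size `≡ 1`) resp. without the Type-I
  rate (witness the constant field `f₀`, which IS KNSS-mild): both FALSE.
* `smallAtMinusInfinityLiouville_false_without_mild` — the gap stub without the gauge: FALSE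
  (parasitic `(1 − t)⁻¹f₀`: Type-I, small at `−∞`, nonzero).
* `selfSimilarLeaf_false_without_mild` — the `A = 0` row of the foreign leaf (Tsai; the lead's stub 5a,
  and a fortiori the planner's `stub_spiralScalingLiouville`) without the gauge: FALSE (`(−t)^{-1/2}f₀` is
  backward self-similar, `u + 2t∂_t u = 0`): the constant profile Tsai's theorem leaves is removed only
  by the gauge.
* `rotatedSelfSimilarLiouville_false_without_mild` — the open core `A ≠ 0` without the gauge: FALSE
  (ROTATING parasitic mode `(−t)^{-1/2}(cos(½log(−t))f₀ + sin(½log(−t))e₁)`, `A = J`).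
-/

noncomputable section

namespace Summit.NavierStokesRegularity.NavierStokesRegularity.Theorems.SymmetricLiouville.Negative

open Literature.Analysis.FluidPDE MeasureTheory Set Function Filter
open scoped RealInnerProductSpace Topology

local notation "E3" => EuclideanSpace ℝ (Fin 3)

/-! ## Stub 1: the side condition `a ∉ range A` is load-bearing -/

/-- The rotation generator about the `x₂`-axis, `J x = (−x₁, x₀, 0)`, as a continuous linear map. -/
def rotJ : E3 →L[ℝ] E3 :=
  (EuclideanSpace.proj (0 : Fin 3) : E3 →L[ℝ] ℝ).smulRight (EuclideanSpace.single (1 : Fin 3) (1 : ℝ)) -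
    (EuclideanSpace.proj (1 : Fin 3) : E3 →L[ℝ] ℝ).smulRight (EuclideanSpace.single (0 : Fin 3) (1 : ℝ))

/-- `J x = x₀ e₁ − x₁ e₀`. -/
theorem rotJ_apply (x : E3) :
    rotJ x = (x 0) • EuclideanSpace.single (1 : Fin 3) (1 : ℝ) -
      (x 1) • EuclideanSpace.single (0 : Fin 3) (1 : ℝ) := by
  simp [rotJ]

/-- `J f₀ = e₁`. -/
theorem rotJ_f0 : rotJ f0 = e1 := by
  rw [rotJ_apply]; simp [f0, e1]

/-- `J e₁ = −f₀`. -/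
theorem rotJ_e1 : rotJ e1 = -f0 := by
  rw [rotJ_apply]; simp [f0, e1]

/-- `J` is skew: `⟪Jx, x⟫ = 0`. -/
theorem inner_rotJ_self (x : E3) : ⟪rotJ x, x⟫ = 0 := by
  rw [rotJ_apply, inner_sub_left, real_inner_smul_left, real_inner_smul_left,
    EuclideanSpace.inner_single_left, EuclideanSpace.inner_single_left]
  simp
  ring

/-- `J ≠ 0` (`J f₀ = e₁`). -/
theorem rotJ_ne_zero : rotJ ≠ 0 := by
  intro h
  have h1 : rotJ f0 = 0 := by rw [h]; rfl
  rw [rotJ_f0] at h1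
  exact e1_ne_zero h1

/-- Stub 1 of `blowdown-kills-pitch` with the side condition flipped to the complementary
conjugacy class `a ∈ range A`, `A ≠ 0` (rotation about a shifted axis): "there is a common nonzero
period for all fields annihilated by `(a + Ax)·∇ − A`". -/
def ScrewIsPeriodicOfMemRange : Prop :=
  ∀ (a : E3) (A : E3 →L[ℝ] E3), (∀ x, ⟪A x, x⟫ = 0) → A ≠ 0 → a ∈ Set.range A →
    ∃ e : E3, e ≠ 0 ∧ ∀ v : E3 → E3, Differentiable ℝ v →
      (∀ x, fderiv ℝ v x (a + A x) = A (v x)) → ∀ x, v (x + e) = v x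

/-- **The side condition `a ∉ range A` of stub 1 is load-bearing**: for a pure rotation
(`A = J`, `a = 0 ∈ range J`) the identity field satisfies the Killing clause `D(id)(x)[Jx] = J(id x)`
and has no period. (So the screw ⊃ lattice bridge is exactly as strong as stated: rotations carry
no length.) [folklore] -/
theorem screwIsPeriodic_false_of_mem_range : ¬ ScrewIsPeriodicOfMemRange := by
  intro h
  obtain ⟨e, he, hper⟩ := h 0 rotJ inner_rotJ_self rotJ_ne_zero ⟨0, by simp⟩
  have key := hper id differentiable_id (fun x => by simp) 0
  simp only [id_eq, zero_add] at key
  exact he key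

/-! ## The self-similar parasitic mode `(−t)^{-1/2} f₀` -/

/-- The self-similar parasitic mode `u(t, x) = (−t)^{-1/2} f₀` (spatially constant). -/
def sqrtField : ℝ → E3 → E3 := fun t _ => (Real.sqrt (-t))⁻¹ • f0

/-- Unfolding the mode. -/
theorem sqrtField_apply (t : ℝ) (x : E3) : sqrtField t x = (Real.sqrt (-t))⁻¹ • f0 := rfl

/-- It is jointly smooth on `t < 0`. -/
theorem sqrtField_smooth : ContDiffOn ℝ (⊤ : ℕ∞) (uncurry sqrtField) (Iio 0 ×ˢ univ) := by
  rintro ⟨t, x⟩ ⟨ht, -⟩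
  simp only [mem_Iio] at ht
  have hs : ContDiffAt ℝ ((⊤ : ℕ∞) : WithTop ℕ∞) (fun w : ℝ × E3 => Real.sqrt (-w.1)) (t, x) :=
    (Real.contDiffAt_sqrt (by simp; linarith : -(t, x).1 ≠ 0)).comp (t, x) contDiffAt_fst.neg
  have hne : Real.sqrt (-(t, x).1) ≠ 0 := (Real.sqrt_pos.2 (by simp; linarith)).ne'
  have h : ContDiffAt ℝ ((⊤ : ℕ∞) : WithTop ℕ∞) (fun w : ℝ × E3 => (Real.sqrt (-w.1))⁻¹ • f0)
      (t, x) := (hs.inv hne).smul contDiffAt_const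
  exact h.contDiffWithinAt

/-- Its slices are divergence free (spatially constant). -/
theorem sqrtField_divFree (t : ℝ) : VectorCalculus.IsDivFree (sqrtField t) :=
  isDivFree_fun_const _

/-- It is Type-I with constant `1` (with equality). -/
theorem sqrtField_typeI : HasTypeITimeDecay 1 sqrtField := by
  intro t ht x
  have hs : 0 < Real.sqrt (-t) := Real.sqrt_pos.2 (by linarith)
  rw [sqrtField_apply, norm_smul, norm_inv, Real.norm_of_nonneg hs.le, norm_f0, mul_one,
    inv_eq_one_div]

/-- Its scale-invariant size is identically `1`. -/
theorem sqrt_mul_norm_sqrtField {t : ℝ} (ht : t < 0) (x : E3) :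
    Real.sqrt (-t) * ‖sqrtField t x‖ = 1 := by
  have hs : 0 < Real.sqrt (-t) := Real.sqrt_pos.2 (by linarith)
  rw [sqrtField_apply, norm_smul, norm_inv, Real.norm_of_nonneg hs.le, norm_f0, mul_one,
    mul_inv_cancel₀ hs.ne']

/-- Time derivative of the mode: `∂_t (−t)^{-1/2} f₀ = (2√(−t))⁻¹ (−t)⁻¹ • f₀`. -/
theorem hasDerivAt_sqrtField {t : ℝ} (ht : t < 0) (x : E3) :
    HasDerivAt (fun s => sqrtField s x)
      ((-(1 / (2 * Real.sqrt (-t)) * (-1)) / (Real.sqrt (-t)) ^ 2) • f0) t := by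
  have h1 : HasDerivAt (fun s : ℝ => Real.sqrt (-s)) (1 / (2 * Real.sqrt (-t)) * (-1)) t :=
    (Real.hasDerivAt_sqrt (by linarith : -t ≠ 0)).comp t (hasDerivAt_neg t)
  have hne : Real.sqrt (-t) ≠ 0 := (Real.sqrt_pos.2 (by linarith)).ne'
  have h2 := (h1.inv hne).smul_const f0
  exact h2

/-- The mode is backward self-similar about the space–time origin: `u + 2t ∂_t u = 0`. -/
theorem sqrtField_selfSimilar {t : ℝ} (ht : t < 0) (x : E3) :
    sqrtField t x + (2 * t) • timeDeriv sqrtField t x = 0 := by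
  rw [timeDeriv_apply, (hasDerivAt_sqrtField ht x).deriv, sqrtField_apply, smul_smul, ← add_smul]
  have hs : 0 < Real.sqrt (-t) := Real.sqrt_pos.2 (by linarith)
  have hr2 : Real.sqrt (-t) ^ 2 = -t := Real.sq_sqrt (by linarith)
  have hcoef : (Real.sqrt (-t))⁻¹ +
      2 * t * (-(1 / (2 * Real.sqrt (-t)) * (-1)) / Real.sqrt (-t) ^ 2) = 0 := by
    have h2t : (2 : ℝ) * t = -(2 * Real.sqrt (-t) ^ 2) := by rw [hr2]; ring
    rw [h2t]
    field_simp
    ring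
  rw [hcoef, zero_smul]

/-- The mode does not vanish (`u(−1, 0) = f₀`). -/
theorem sqrtField_ne_zero : sqrtField (-1) 0 ≠ 0 := by
  rw [sqrtField_apply, neg_neg, Real.sqrt_one, inv_one, one_smul]
  exact f0_ne_zero

/-! ## Stub 3 (the lever): the gauge and the rate are load-bearing -/

/-- Stub 3 of `blowdown-kills-pitch` with the Oseen integral equation dropped from the class. -/
def PeriodicBlowdownVanishingWithoutMild : Prop :=
  ∀ (C : ℝ) (u : ℝ → E3 → E3),
    ContDiffOn ℝ (⊤ : ℕ∞) (uncurry u) (Iio 0 ×ˢ univ) → (∀ t < 0, VectorCalculus.IsDivFree (u t)) →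
    HasTypeITimeDecay C u →
    ∀ e : E3, e ≠ 0 → (∀ t < 0, ∀ x, u t (x + e) = u t x) →
    ∀ ε > 0, ∃ T < 0, ∀ t < T, ∀ x, Real.sqrt (-t) * ‖u t x‖ ≤ ε

/-- **The gauge is load-bearing for the lever**: without the Oseen integral equation the
self-similar parasitic mode `(−t)^{-1/2} f₀` is smooth, divergence free, Type-I (`C = 1`), periodic
in every direction, and has scale-invariant size `1` at all times. [folklore] -/
theorem periodicBlowdownVanishing_false_without_mild : ¬ PeriodicBlowdownVanishingWithoutMild := by
  intro h
  obtain ⟨T, hT, hsmall⟩ := h 1 sqrtField sqrtField_smooth (fun t _ => sqrtField_divFree t)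
    sqrtField_typeI f0 f0_ne_zero (fun t _ x => rfl) (1 / 2) (by norm_num)
  have key := hsmall (T - 1) (by linarith) 0
  rw [sqrt_mul_norm_sqrtField (by linarith) 0] at key
  norm_num at key

/-- Stub 3 of `blowdown-kills-pitch` with the Type-I bound dropped from the class (smooth,
divergence free, KNSS-mild in the literal route form, periodic). -/
def PeriodicBlowdownVanishingWithoutTypeI : Prop :=
  ∀ (u : ℝ → E3 → E3),
    ContDiffOn ℝ (⊤ : ℕ∞) (uncurry u) (Iio 0 ×ˢ univ) → (∀ t < 0, VectorCalculus.IsDivFree (u t)) →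
    (∀ s t : ℝ, s < t → t < 0 → ∀ x, u t x = heatFlow (u s) (t - s) x -
      ∫ τ in Set.Ioo s t, ∫ y, oseenKernel (t - τ) (x - y) (u τ y) (u τ y)) →
    ∀ e : E3, e ≠ 0 → (∀ t < 0, ∀ x, u t (x + e) = u t x) →
    ∀ ε > 0, ∃ T < 0, ∀ t < T, ∀ x, Real.sqrt (-t) * ‖u t x‖ ≤ ε

/-- **The Type-I rate is load-bearing for the lever**: the constant field `f₀` is smooth,
divergence free, KNSS-mild (`constField_mild`) and periodic, with `√(−t)‖f₀‖ = √(−t) → ∞`. [folklore] -/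
theorem periodicBlowdownVanishing_false_without_typeI : ¬ PeriodicBlowdownVanishingWithoutTypeI := by
  intro h
  obtain ⟨T, hT, hsmall⟩ := h constField constField_smooth constField_divFree constField_mild
    f0 f0_ne_zero (fun t _ x => rfl) (1 / 2) (by norm_num)
  have key : Real.sqrt (-(T - 1)) * ‖f0‖ ≤ 1 / 2 := hsmall (T - 1) (by linarith) 0
  have h1 : (1 : ℝ) ≤ Real.sqrt (-(T - 1)) := by
    have e1 : (1 : ℝ) = Real.sqrt 1 := Real.sqrt_one.symm
    rw [e1]
    exact Real.sqrt_le_sqrt (by linarith)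
  rw [norm_f0, mul_one] at key
  linarith

/-! ## Stub 4 (the Kato gap): the gauge is load-bearing -/

/-- Stub 4 of `blowdown-kills-pitch` with the Oseen integral equation dropped from the class. -/
def SmallAtMinusInfinityLiouvilleWithoutMild : Prop :=
  ∀ (C : ℝ) (u : ℝ → E3 → E3),
    ContDiffOn ℝ (⊤ : ℕ∞) (uncurry u) (Iio 0 ×ˢ univ) → (∀ t < 0, VectorCalculus.IsDivFree (u t)) →
    HasTypeITimeDecay C u →
    (∀ ε > 0, ∃ T < 0, ∀ t < T, ∀ x, Real.sqrt (-t) * ‖u t x‖ ≤ ε) →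
    ∀ t < 0, ∀ x, u t x = 0

/-- **The gauge is load-bearing for the gap stub**: the parasitic field `(1 − t)⁻¹ f₀` is smooth,
divergence free, Type-I (`C = 1`), small at `−∞` in scale-invariant size
(`√(−t)/(1 − t) ≤ 1/√(−t)`), and nonzero. [folklore] -/
theorem smallAtMinusInfinityLiouville_false_without_mild :
    ¬ SmallAtMinusInfinityLiouvilleWithoutMild := by
  intro h
  refine parasiticField_not_vanishes (h 1 parasiticField parasiticField_smooth
    parasiticField_divFree parasiticField_typeI ?_)
  intro ε hε
  refine ⟨-(1 / ε ^ 2), by simp; positivity, fun t ht x => ?_⟩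
  have ht0 : t < 0 := lt_of_lt_of_le ht (by simp; positivity)
  have hs : 0 < Real.sqrt (-t) := Real.sqrt_pos.2 (by linarith)
  have h1t : 0 < 1 - t := by linarith
  have hnorm : ‖parasiticField t x‖ = (1 - t)⁻¹ := by
    simp only [parasiticField, norm_smul, norm_inv, Real.norm_eq_abs, abs_of_pos h1t, norm_f0,
      mul_one]
  rw [hnorm]
  -- `√(-t)/(1 - t) ≤ √(-t)/(-t) = 1/√(-t) ≤ ε`
  have hsq : Real.sqrt (-t) ^ 2 = -t := Real.sq_sqrt (by linarith)
  have h2 : Real.sqrt (-t) * (1 - t)⁻¹ ≤ (Real.sqrt (-t))⁻¹ := by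
    rw [mul_inv_le_iff₀ h1t, le_inv_mul_iff₀ hs, ← sq, hsq]
    linarith
  have h3 : (Real.sqrt (-t))⁻¹ ≤ ε := by
    rw [inv_le_comm₀ hs hε, Real.le_sqrt' (inv_pos.2 hε)]
    have h4 : ε⁻¹ ^ 2 = 1 / ε ^ 2 := by rw [inv_pow, one_div]
    rw [h4]
    linarith
  exact h2.trans h3

/-! ## Stubs 5a / 5 (self-similar leaf, Tsai's row `A = 0`): the gauge is load-bearing -/

/-- Stub 5a of the lead's reshaped skeleton (`stub_selfSimilarLeaf`, the `A = 0` row) with the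
Oseen integral equation dropped from the class. -/
def SelfSimilarLeafWithoutMild : Prop :=
  ∀ (C : ℝ) (u : ℝ → E3 → E3),
    ContDiffOn ℝ (⊤ : ℕ∞) (uncurry u) (Iio 0 ×ˢ univ) → (∀ t < 0, VectorCalculus.IsDivFree (u t)) →
    HasTypeITimeDecay C u →
    (∀ t < 0, ∀ x, fderiv ℝ (u t) x x + u t x + (2 * t) • timeDeriv u t x = 0) →
    ∀ t < 0, ∀ x, u t x = 0

/-- **The gauge is load-bearing for the self-similar leaf** (Tsai's row): without the Oseen
integral equation the mode `(−t)^{-1/2} f₀` is a smooth, divergence-free, Type-I (`C = 1`),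
backward self-similar, nonzero field. [folklore] -/
theorem selfSimilarLeaf_false_without_mild : ¬ SelfSimilarLeafWithoutMild := by
  intro h
  refine sqrtField_ne_zero (h 1 sqrtField sqrtField_smooth (fun t _ => sqrtField_divFree t)
    sqrtField_typeI ?_ (-1) (by norm_num) 0)
  intro t ht x
  have hconst : fderiv ℝ (sqrtField t) x = 0 := by
    rw [show sqrtField t = fun _ => (Real.sqrt (-t))⁻¹ • f0 from rfl]
    exact fderiv_const_apply _
  simp only [hconst, zero_apply, zero_add]
  exact sqrtField_selfSimilar ht x

/-! ## Stub 5b (the open core, `A ≠ 0`): the gauge is load-bearing there too -/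

/-- The rotating self-similar parasitic mode
`u(t, x) = (−t)^{-1/2} (cos(½ log(−t)) f₀ + sin(½ log(−t)) e₁)` (spatially constant). -/
def rssMode : ℝ → E3 → E3 := fun t _ =>
  (Real.sqrt (-t))⁻¹ • (Real.cos (Real.log (-t) / 2) • f0 + Real.sin (Real.log (-t) / 2) • e1)

/-- Unfolding the mode. -/
theorem rssMode_apply (t : ℝ) (x : E3) : rssMode t x =
    (Real.sqrt (-t))⁻¹ • (Real.cos (Real.log (-t) / 2) • f0 + Real.sin (Real.log (-t) / 2) • e1) := rfl

/-- It is jointly smooth on `t < 0`. -/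
theorem rssMode_smooth : ContDiffOn ℝ (⊤ : ℕ∞) (uncurry rssMode) (Iio 0 ×ˢ univ) := by
  rintro ⟨t, x⟩ ⟨ht, -⟩
  simp only [mem_Iio] at ht
  have hneg : ContDiffAt ℝ ((⊤ : ℕ∞) : WithTop ℕ∞) (fun w : ℝ × E3 => -w.1) (t, x) :=
    contDiffAt_fst.neg
  have hne : -(t, x).1 ≠ 0 := by simp; linarith
  have hs : ContDiffAt ℝ ((⊤ : ℕ∞) : WithTop ℕ∞) (fun w : ℝ × E3 => Real.sqrt (-w.1)) (t, x) :=
    (Real.contDiffAt_sqrt hne).comp (t, x) hneg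
  have hsne : Real.sqrt (-(t, x).1) ≠ 0 := (Real.sqrt_pos.2 (by simp; linarith)).ne'
  have hlog : ContDiffAt ℝ ((⊤ : ℕ∞) : WithTop ℕ∞) (fun w : ℝ × E3 => Real.log (-w.1) / 2) (t, x) :=
    ((Real.contDiffAt_log.2 hne).comp (t, x) hneg).div_const 2
  have hc : ContDiffAt ℝ ((⊤ : ℕ∞) : WithTop ℕ∞)
      (fun w : ℝ × E3 => Real.cos (Real.log (-w.1) / 2)) (t, x) :=
    Real.contDiff_cos.contDiffAt.comp (t, x) hlog
  have hsi : ContDiffAt ℝ ((⊤ : ℕ∞) : WithTop ℕ∞)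
      (fun w : ℝ × E3 => Real.sin (Real.log (-w.1) / 2)) (t, x) :=
    Real.contDiff_sin.contDiffAt.comp (t, x) hlog
  have h : ContDiffAt ℝ ((⊤ : ℕ∞) : WithTop ℕ∞) (fun w : ℝ × E3 => (Real.sqrt (-w.1))⁻¹ •
      (Real.cos (Real.log (-w.1) / 2) • f0 + Real.sin (Real.log (-w.1) / 2) • e1)) (t, x) :=
    (hs.inv hsne).smul ((hc.smul contDiffAt_const).add (hsi.smul contDiffAt_const))
  exact h.contDiffWithinAt

/-- Its slices are divergence free (spatially constant). -/
theorem rssMode_divFree (t : ℝ) : VectorCalculus.IsDivFree (rssMode t) :=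
  isDivFree_fun_const _

/-- The rotating unit vector has norm at most `2`. -/
theorem norm_rot_le (φ : ℝ) : ‖Real.cos φ • f0 + Real.sin φ • e1‖ ≤ 2 := by
  calc ‖Real.cos φ • f0 + Real.sin φ • e1‖ ≤ ‖Real.cos φ • f0‖ + ‖Real.sin φ • e1‖ := norm_add_le _ _
    _ = |Real.cos φ| + |Real.sin φ| := by
        rw [norm_smul, norm_smul, norm_f0, norm_e1, mul_one, mul_one, Real.norm_eq_abs,
          Real.norm_eq_abs]
    _ ≤ 1 + 1 := add_le_add (Real.abs_cos_le_one φ) (Real.abs_sin_le_one φ)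
    _ = 2 := by norm_num

/-- It is Type-I with constant `2`. -/
theorem rssMode_typeI : HasTypeITimeDecay 2 rssMode := by
  intro t ht x
  have hs : 0 < Real.sqrt (-t) := Real.sqrt_pos.2 (by linarith)
  rw [rssMode_apply, norm_smul, norm_inv, Real.norm_of_nonneg hs.le, div_eq_mul_inv, mul_comm]
  exact mul_le_mul_of_nonneg_right (norm_rot_le _) (inv_nonneg.2 hs.le)

/-- The mode does not vanish (`u(−1, 0) = f₀`). -/
theorem rssMode_ne_zero : rssMode (-1) 0 ≠ 0 := by
  rw [rssMode_apply, neg_neg, Real.sqrt_one, inv_one, one_smul, Real.log_one, zero_div,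
    Real.cos_zero, Real.sin_zero, one_smul, zero_smul, add_zero]
  exact f0_ne_zero

/-- Time derivative of the mode. -/
theorem hasDerivAt_rssMode {t : ℝ} (ht : t < 0) (x : E3) :
    HasDerivAt (fun s => rssMode s x)
      ((Real.sqrt (-t))⁻¹ •
          ((-Real.sin (Real.log (-t) / 2) * ((-t)⁻¹ * (-1) / 2)) • f0 +
            (Real.cos (Real.log (-t) / 2) * ((-t)⁻¹ * (-1) / 2)) • e1) +
        (-(1 / (2 * Real.sqrt (-t)) * (-1)) / (Real.sqrt (-t)) ^ 2) •
          (Real.cos (Real.log (-t) / 2) • f0 + Real.sin (Real.log (-t) / 2) • e1)) t := by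
  have hne : -t ≠ 0 := by linarith
  have h1 : HasDerivAt (fun s : ℝ => Real.sqrt (-s)) (1 / (2 * Real.sqrt (-t)) * (-1)) t :=
    (Real.hasDerivAt_sqrt hne).comp t (hasDerivAt_neg t)
  have hsne : Real.sqrt (-t) ≠ 0 := (Real.sqrt_pos.2 (by linarith)).ne'
  have hamp := h1.inv hsne
  have hφ : HasDerivAt (fun s : ℝ => Real.log (-s) / 2) ((-t)⁻¹ * (-1) / 2) t :=
    ((Real.hasDerivAt_log hne).comp t (hasDerivAt_neg t)).div_const 2
  have hc : HasDerivAt (fun s : ℝ => Real.cos (Real.log (-s) / 2))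
      (-Real.sin (Real.log (-t) / 2) * ((-t)⁻¹ * (-1) / 2)) t := hφ.cos
  have hsi : HasDerivAt (fun s : ℝ => Real.sin (Real.log (-s) / 2))
      (Real.cos (Real.log (-t) / 2) * ((-t)⁻¹ * (-1) / 2)) t := hφ.sin
  have hV : HasDerivAt (fun s : ℝ => Real.cos (Real.log (-s) / 2) • f0 + Real.sin (Real.log (-s) / 2) • e1)
      ((-Real.sin (Real.log (-t) / 2) * ((-t)⁻¹ * (-1) / 2)) • f0 +
        (Real.cos (Real.log (-t) / 2) * ((-t)⁻¹ * (-1) / 2)) • e1) t :=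
    (hc.smul_const f0).add (hsi.smul_const e1)
  exact hamp.smul hV

/-- The mode is rotated self-similar about the origin with rate `J`: `u + 2t ∂_t u − J u = 0`. -/
theorem rssMode_clause {t : ℝ} (ht : t < 0) (x : E3) :
    rssMode t x + (2 * t) • timeDeriv rssMode t x - rotJ (rssMode t x) = 0 := by
  rw [timeDeriv_apply, (hasDerivAt_rssMode ht x).deriv, rssMode_apply]
  set R : ℝ := Real.sqrt (-t) with hR
  set c : ℝ := Real.cos (Real.log (-t) / 2) with hc
  set s : ℝ := Real.sin (Real.log (-t) / 2) with hs
  have hR0 : 0 < R := Real.sqrt_pos.2 (by linarith)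
  have hR2 : R ^ 2 = -t := Real.sq_sqrt (by linarith)
  have ht' : t = -R ^ 2 := by linarith
  simp only [map_smul, map_add, rotJ_f0, rotJ_e1, smul_add, smul_smul, smul_neg]
  rw [ht']
  have hRne : R ≠ 0 := hR0.ne'
  match_scalars <;> field_simp <;> ring


/-- Stub 5b of the lead's reshaped skeleton (`stub_rotatedSelfSimilarLiouville`, every skew
`A ≠ 0`) with the Oseen integral equation dropped from the class. -/
def RotatedSelfSimilarLiouvilleWithoutMild : Prop :=
  ∀ (C : ℝ) (u : ℝ → E3 → E3),
    ContDiffOn ℝ (⊤ : ℕ∞) (uncurry u) (Iio 0 ×ˢ univ) → (∀ t < 0, VectorCalculus.IsDivFree (u t)) →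
    HasTypeITimeDecay C u →
    ∀ A : E3 →L[ℝ] E3, (∀ x, ⟪A x, x⟫ = 0) → A ≠ 0 →
      (∀ t < 0, ∀ x, fderiv ℝ (u t) x (x + A x) + u t x + (2 * t) • timeDeriv u t x - A (u t x) = 0) →
      ∀ t < 0, ∀ x, u t x = 0

/-- **The gauge is load-bearing for the rotated self-similar leaf as well** (`A = J ≠ 0`): without
the Oseen integral equation the ROTATING parasitic mode
`(−t)^{-1/2}(cos(½log(−t)) f₀ + sin(½log(−t)) e₁)` is smooth, divergence free, Type-I (`C = 2`),
annihilated by the rotated-scaling generator `x·∇ + 1 + 2t∂_t + (Jx)·∇ − J`, and nonzero — a bounded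
"profile" spinning at rate `J` in similarity variables, `u = (−t)^{-1/2} e^{(½log(−t))J} f₀`. So on
the open core, too, a proof must consume the KNSS gauge (no duality-form class suffices). [folklore] -/
theorem rotatedSelfSimilarLiouville_false_without_mild : ¬ RotatedSelfSimilarLiouvilleWithoutMild := by
  intro h
  refine rssMode_ne_zero (h 2 rssMode rssMode_smooth (fun t _ => rssMode_divFree t) rssMode_typeI
    rotJ inner_rotJ_self rotJ_ne_zero ?_ (-1) (by norm_num) 0)
  intro t ht x
  have hconst : fderiv ℝ (rssMode t) x = 0 := by
    rw [show rssMode t = fun _ => rssMode t x from rfl]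
    exact fderiv_const_apply _
  simp only [hconst, zero_apply, zero_add]
  exact rssMode_clause ht x

end Summit.NavierStokesRegularity.NavierStokesRegularity.Theorems.SymmetricLiouville.Negative

end
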